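import Mathlib
import Summits.KontsevichZagierPeriods.Zeta5Search.ClassTypeGuards
import Summits.KontsevichZagierPeriods.Zeta5Search.T1RayKit
import Summits.KontsevichZagierPeriods.Zeta5Search.ZeroWindowKit
import HarnessLib

/-!
# ζ(5) search — a COVER KIT for the ZERO type-space law (`ResidueLaw.typeSpaceLawZero_holds`, `casLB + 3`): `ZeroWindowClasses` from a class-type cover — DENOM-LAW prover-d1 gen 17

HONEST FRAMING: systematic search; no irrationality claim unless certified.  Cell `pub-zeta5`, track «DENOM-LAW», seat `denom-prover-d1`
gen 17 (`HOME/denom-law/prover-d1/ATTEMPT-17.md` §D).  `p`-adic valuation bookkeeping for the explicit rationals `Cas_j(b)`; nothing about ζ(5);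
no model exponent moves; records in print UNMOVED.

Zero-regime twin of `DenomLaw/OriginCoverKit`.  The ZERO-regime type-space law (gen-2 g11; PROVED, p3: `typeSpaceLawZero_holds`) is consumed through
census g21 / p3 gen 3's reduction `ZeroWindows.bound_of_classes : ZeroWindowClasses b p M D S ∧ (D palindromic) ∧ |D| + |S| ≤ 2 ⇒ v_p(Cas_j(b)) ≥ 6 − 2M`
(any `b`, any `j`; no line data — pigeonhole on at most two doubled points).  This file turns the class-structure half into a type-level Boolean check
over a class-type COVER of the residues (`ClassTypeCover.Cover`): the three clauses of `ZeroWindowClasses` — every pole type `E ≥ −M`; exponent `−M`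
⇒ centre-free with `T ∈ D`; exponent `−M+1` ⇒ a single raise of a deep type / the odd-centre deep type / centre-free with `T` OR ITS REVERSAL in `S`
(the conjugate class carries the reversed type list, `ZeroWindows.classTypeList_conj`) — spelled out as a `List.all` (no new definition), the transfer
theorem `zeroClasses_of_cover`, the any-`j` wrapper `zeroBound_of_classes` (DEG as `p(M − 2) ≤ 2d + 1` by `ResidueLaw.sum_classExp_range`) and its
universal `M = 8` instance `zero_Z8` (`ZeroWindows.D8 = [[1,−5,−5,1]]`, `T1Rays.Sz8 = [[1,−6,−3,1]]`: `−10`).  MOTIVATION (ATTEMPT-17 §D): on the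
general-`b` profile `N_p = 19` the cell `3p ≤ d` (node value `−10`) is a ZERO window at `M = 8` with exactly this universal inventory.  Valuations of
explicit rationals; every model exponent these feed is `< 1`.
-/

open Finset

namespace Summit.KontsevichZagierPeriods.Zeta5Search.DenomLaw

open Summit.KontsevichZagierPeriods.Zeta5Search.ClusterValuation
open Summit.KontsevichZagierPeriods.Zeta5Search.CasoratianValuation (InPolytope shift casoratian)
open Summit.KontsevichZagierPeriods.Zeta5Search.WedgeDictionary (dOf)
open Summit.KontsevichZagierPeriods.Zeta5Search.ClassTypeCover
open Summit.KontsevichZagierPeriods.Zeta5Search.SecondOrder (classTypeList isRaise)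
open Summit.KontsevichZagierPeriods.Zeta5Search.ZeroWindows (ZeroWindowClasses classTypeList_conj)
open Summit.KontsevichZagierPeriods.Zeta5Search.ResidueLaw (sum_classExp_range)

variable {p : ℕ}

/-- **`ZeroWindowClasses` from a cover** (type-level transfer): if every residue is a typed level class of a type in `TY` and, on the list, every pole
type `(T, cen)` has `E ≥ −M`, the types of exponent `−M` are centre-free with `T ∈ D`, and the types of exponent `−M+1` are single raises of a member
of `D`, or (odd `b₀`) centre types equal to a member of `D`, or centre-free with `T ∈ S` or `T.reverse ∈ S` — then `ZeroWindowClasses b p M D S`. -/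
theorem zeroClasses_of_cover [Fact p.Prime] {b : ℕ → ℤ} (hb0 : 0 ≤ b 0) {TY : List (List ℤ × Bool)} (hcov : Cover b p TY) {M : ℕ}
    {D S : List (List ℤ)}
    (hchk : (TY.all fun tc =>
      decide (polesL tc.1 = 0) ||
      ((decide (-(M : ℤ) ≤ expL (decide (¬ (2 : ℤ) ∣ b 0)) tc.1 tc.2) &&
        (!decide (expL (decide (¬ (2 : ℤ) ∣ b 0)) tc.1 tc.2 = -(M : ℤ)) || (!tc.2 && decide (tc.1 ∈ D)))) &&
        (!decide (expL (decide (¬ (2 : ℤ) ∣ b 0)) tc.1 tc.2 = -(M : ℤ) + 1) ||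
          (D.any (fun T => isRaise T tc.1 || (decide (¬ (2 : ℤ) ∣ b 0) && tc.2 && decide (tc.1 = T))) ||
            (!tc.2 && (decide (tc.1 ∈ S) || decide (tc.1.reverse ∈ S))))))) = true) :
    ZeroWindowClasses b p M D S := by
  rw [List.all_eq_true] at hchk
  refine ⟨?_, ?_, ?_⟩
  · intro x hx h1
    obtain ⟨tc, htc, ht⟩ := hcov x hx
    have hc := hchk tc htc
    simp only [Bool.and_eq_true, Bool.or_eq_true, Bool.not_eq_true', decide_eq_false_iff_not, decide_eq_true_eq] at hc
    rw [ht.classPoleCount_eq] at h1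
    rw [ht.classExp_eq]
    rcases hc with h | ⟨⟨h, -⟩, -⟩
    · omega
    · exact h
  · intro x hx h1 hE
    obtain ⟨tc, htc, ht⟩ := hcov x hx
    have hc := hchk tc htc
    simp only [Bool.and_eq_true, Bool.or_eq_true, Bool.not_eq_true', decide_eq_false_iff_not, decide_eq_true_eq] at hc
    rw [ht.classPoleCount_eq] at h1
    rw [ht.classExp_eq] at hE
    rcases hc with h | ⟨⟨-, h | ⟨hc1, hc2⟩⟩, -⟩
    · omega
    · exact absurd hE h
    · refine ⟨fun hcen => ?_, by rw [ht.classTypeList_eq]; exact hc2⟩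
      rw [ht.cen_iff.1 hcen] at hc1
      exact Bool.noConfusion hc1
  · intro y hy h1 hE
    obtain ⟨tc, htc, ht⟩ := hcov y hy
    have hc := hchk tc htc
    simp only [Bool.and_eq_true, Bool.or_eq_true, Bool.not_eq_true', decide_eq_false_iff_not, decide_eq_true_eq,
      List.any_eq_true] at hc
    rw [ht.classPoleCount_eq] at h1
    rw [ht.classExp_eq] at hE
    rcases hc with h | ⟨-, h | (⟨T, hTD, hT⟩ | ⟨hc1, hc2⟩)⟩
    · omega
    · exact absurd hE h
    · left
      refine ⟨T, hTD, ?_⟩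
      rcases hT with hr | ⟨⟨ho, hc1⟩, hc2⟩
      · left; rw [ht.classTypeList_eq]; exact hr
      · right; exact ⟨ho, ht.cen_iff.2 hc1, by rw [ht.classTypeList_eq]; exact hc2⟩
    · right
      have hncen : ¬ CentreIn b p y := fun hcen => by
        rw [ht.cen_iff.1 hcen] at hc1
        exact Bool.noConfusion hc1
      refine ⟨hncen, ?_⟩
      rcases hc2 with hs | hs
      · exact ⟨tc.1, hs, Or.inl ht.classTypeList_eq⟩
      · refine ⟨tc.1.reverse, hs, Or.inr ?_⟩
        obtain ⟨hL, hL'⟩ := ht.bounds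
        rw [classTypeList_conj b hb0 hy hL hL', ht.classTypeList_eq]

/-- **ZERO TYPE-SPACE BOUND from the class structure, any direction `j`** (`ZeroWindows.bound_of_classes` with the degree condition in the form
`p(M − 2) ≤ 2d(b) + 1`): on the polytope with `5 ≤ p ≤ b₀ < p² − 2`, `M ≥ 6` even, `D` palindromic with `|D| + |S| ≤ 2` and the class structure
`ZeroWindowClasses b p M D S`: `6 − 2M ≤ v_p(Cas_j(b))`. -/
theorem zeroBound_of_classes {b : ℕ → ℤ} {j : ℕ} (hb : InPolytope b) (hb' : InPolytope (shift b j)) (hj1 : 1 ≤ j) (hj7 : j ≤ 7)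
    (hpr : p.Prime) (hp5 : 5 ≤ p) (hpb : (p : ℤ) ≤ b 0) (hwin : (b 0 + 2 : ℤ) < (p : ℤ) ^ 2)
    {M : ℕ} (hM : 6 ≤ M) (hMe : Even M) {D S : List (List ℤ)} (hD : ∀ T ∈ D, T.reverse = T) (hlen : D.length + S.length ≤ 2)
    (hC : ZeroWindowClasses b p M D S) (hdeg : (p : ℤ) * ((M : ℤ) - 2) ≤ 2 * dOf b + 1)
    (hcas : casoratian b j ≠ 0) : (6 : ℤ) - 2 * M ≤ padicValRat p (casoratian b j) := by
  haveI : Fact p.Prime := ⟨hpr⟩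
  have hdeg' : (p : ℤ) * ((M : ℤ) - 2) + ∑ x ∈ range p, classExp b p x ≤ -4 := by
    rw [sum_classExp_range b hb hp5]; omega
  exact ZeroWindows.bound_of_classes b j M D S hb hb' hj1 hj7 hp5 hpb hwin hM hMe hdeg' hD hlen hC hcas

/-- **The universal `M = 8` ZERO instance** (deep palindrome `ZeroWindows.D8 = [[1,−5,−5,1]]`, extra pair `T1Rays.Sz8 = [[1,−6,−3,1]]`): the class
structure at `(8; D8, Sz8)` and `6p ≤ 2d(b) + 1` give `−10 ≤ v_p(Cas_j(b))` for every admissible `j`. -/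
theorem zero_Z8 {b : ℕ → ℤ} {j : ℕ} (hb : InPolytope b) (hb' : InPolytope (shift b j)) (hj1 : 1 ≤ j) (hj7 : j ≤ 7)
    (hpr : p.Prime) (hp5 : 5 ≤ p) (hpb : (p : ℤ) ≤ b 0) (hwin : (b 0 + 2 : ℤ) < (p : ℤ) ^ 2)
    (hC : ZeroWindowClasses b p 8 ZeroWindows.D8 T1Rays.Sz8)
    (hdeg : (p : ℤ) * 6 ≤ 2 * dOf b + 1) (hcas : casoratian b j ≠ 0) : (-10 : ℤ) ≤ padicValRat p (casoratian b j) := by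
  have h := zeroBound_of_classes hb hb' hj1 hj7 hpr hp5 hpb hwin (M := 8) (by norm_num) (by decide) T1Rays.d8_pal T1Rays.d8_sz8_len hC
    (by simpa using hdeg) hcas
  simpa using h

/-- Sanity of the spelled-out check on the universal `M = 8` zero inventory (the `N_p = 19` profile's live types for odd `b₀`: deep palindrome,
its single raises, the odd-centre copy, and the conjugate pair `[1,−6,−3,1]` / `[1,−3,−6,1]` through `S` and its reversal). -/
example : ([([1, -5, -5, 1], false), ([1, -5, -4, 1], false), ([1, -4, -5, 1], false), ([1, -5, -5, 1], true), ([1, -6, -3, 1], false),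
      ([1, -3, -6, 1], false), ([1, -6, 1], false), ([1, 1], false)] : List (List ℤ × Bool)).all (fun tc =>
      decide (polesL tc.1 = 0) ||
      ((decide (-((8 : ℕ) : ℤ) ≤ expL true tc.1 tc.2) &&
        (!decide (expL true tc.1 tc.2 = -((8 : ℕ) : ℤ)) || (!tc.2 && decide (tc.1 ∈ ZeroWindows.D8)))) &&
        (!decide (expL true tc.1 tc.2 = -((8 : ℕ) : ℤ) + 1) ||
          (ZeroWindows.D8.any (fun T => isRaise T tc.1 || (true && tc.2 && decide (tc.1 = T))) ||
            (!tc.2 && (decide (tc.1 ∈ T1Rays.Sz8) || decide (tc.1.reverse ∈ T1Rays.Sz8))))))) = true := by decide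

end Summit.KontsevichZagierPeriods.Zeta5Search.DenomLaw
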